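import Literature.RepresentationTheory.HeisenbergGroup.MetaplecticSumStrippingRight        -- ★ `spInr`, `inrW` (+ ★ `SchrodingerDirectSum`: `spInl`, `inlW`, `spInl_mul_spInr_comm`)
import Literature.RepresentationTheory.HeisenbergGroup.SymplecticMatrixTransport            -- ★ `transportSp`, `transportSp_levi`, `transportSp_J`, `leviDual`, `levi`
import Literature.NumberTheory.GelbartRogawski1991.LocalUnitaryUndoublingSplitMixedModel   -- ★ `reindex_fromBlocks_mulVec_eq_glue`, `glue_neg`
import Literature.NumberTheory.GelbartRogawski1991.LocalUnitaryFrameTransport              -- ★ `frameSp`, `frameW`, `frameLin`, `framePv`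
import HarnessLib

/-!
# Crux `HLiu418`, #42S organ S1, (G) organ ROW (ρ-mid), bricks [W3] + [W4] of (M2a-C2c): block sums and frame transports of
# the transported Siegel Levi `m(B)` and Weyl element `J` (pure symplectic-matrix algebra)

Cell `hodgecm-mathlib`, crux item hLiu418 = `stmt-HodgeConjecture-24832`, route of record `HCCMUnconditional`; squad K2 ∕ K2Liu,
socket #42S (a), organ S1, (G) organ (K2Liu-p26 (g0) lead 16:48:02Z «[W3]+[W4] … OFFER BY NAME», K2Liu-p23 (g0) second hand).
THEOREMS ONLY (no `def`, no `instance`, no `notation`, no named-fact hypothesis, no `sorry`); lane `--supports stmt-HodgeConjecture-24832`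
(count-neutral helper).

WHAT.  The Cayley letter `hW′ : E′ · ι′(w_Δ′) · E′⁻¹ = (transportSp 𝕋′ J)⁻¹ · transportSp 𝕋′ (levi B′)` of ★ F4a must be produced at the
TENSOR datum from the two block letters `hW₁`, `hW₂`; the two algebra bricks it needs are:

* §2 **[W3] BLOCK SUMS** (generic commutative ring `K`, `e : ι₁ ⊕ ι₂ ≃ ι`, `T = reindex e e (T₁ ⊕ T₂)`, `B = reindex e e (B₁ ⊕ B₂)`):
  `spInl (transportSp T₁ (levi B₁)) * spInr (transportSp T₂ (levi B₂)) = transportSp T (levi B)` (`spInl_transportSp_levi_mul_spInr`),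
  `spInl (transportSp T₁ J) * spInr (transportSp T₂ J) = transportSp T J` (`spInl_transportSp_symJ_mul_spInr`), hence
  `spInl (transportSp T₁ (J⁻¹ levi B₁)) * spInr (transportSp T₂ (J⁻¹ levi B₂)) = transportSp T (J⁻¹ levi B)` and the product form
  `spInl ((tS₁ J)⁻¹ tS₁(levi B₁)) * spInr ((tS₂ J)⁻¹ tS₂(levi B₂)) = (tS J)⁻¹ tS (levi B)` (the two summands commute, ★ `spInl_mul_spInr_comm`).
* §3 **[W4] FRAME TRANSPORT** (the GR91 local frame `frameSp F v N P hP : Sp(𝕎_{T′}) ≃* Sp(𝕎_T)`, `Pᵀ T P = T′`, `P̂ = framePv`):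
  `frameSp (transportSp 𝕋′_v (levi B)) = transportSp 𝕋_v (levi (P̂ B P̂⁻¹))` (`frameSp_transportSp_levi`, NO orthogonality needed), and for an
  ORTHOGONAL frame `P Pᵀ = 1` (e.g. a permutation) `frameSp (transportSp 𝕋′_v J) = transportSp 𝕋_v J` (`frameSp_transportSp_symJ`); hence
  `frameSp ((tS′ J)⁻¹ tS′(levi B)) = (tS J)⁻¹ tS (levi (P̂ B P̂⁻¹))` (`frameSp_transportSp_symJ_inv_mul_levi`).

§1 is the block-matrix bookkeeping (`(A ⊕ B)ᵀ`, `(A ⊕ B)⁻¹`, GL inverses) and the frame bookkeeping (`P̂ᵀ 𝕋_v P̂ = 𝕋′_v`, `𝕋′_v⁻¹ = P̂⁻¹ 𝕋_v⁻¹ P̂⁻ᵀ`).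
CONSUMER: K2Liu-p26's (C2c) `K2LiuWitnessImplementerCayley` with `e := blkIdx n₁ n₂`, `hT := localGram_gramD_finSum`, `P := PD`.
References: [MoeglinVignerasWaldspurger1987] Chap. 2 II.1 Rem. (6), II.2; [Kudla1994] §2; [Weil1964] n° 6, n° 34; [Rangarao1993] §2.2.
HONEST LABEL.  Count-neutral helper; it retires nothing by itself: `HC_CM` is proved only modulo the 7 printed citations (2 remaining named inputs:
hLiu418 = `stmt-HodgeConjecture-24832`, h413 = `stmt-HodgeConjecture-24833`) until rung 0 closes.
-/

set_option autoImplicit false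
set_option linter.dupNamespace false -- the mandated namespace repeats `HodgeConjecture.HodgeConjecture`

noncomputable section

open scoped Matrix
open NumberField IsDedekindDomain Matrix
open Literature.RepresentationTheory.HeisenbergGroup Literature.RepresentationTheory.HeisenbergGroup.SymplecticMatrix
open Literature.NumberTheory.Automorphic
open Literature.NumberTheory.GelbartRogawski1991.UnitaryDualPair.LocalSplitting
open Literature.NumberTheory.GelbartRogawski1991.UnitaryDualPair.LocalSplitting.FrameTransport

namespace Summit.HodgeConjecture.HodgeConjecture.Cruxes.HLiu418.K2LiuSymplecticBlockLeviTransport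

/-! ## §1 Block-matrix bookkeeping along `e : ι₁ ⊕ ι₂ ≃ ι` -/

section Blocks

variable {K : Type*} [CommRing K] {ι₁ ι₂ ι : Type*} [Fintype ι₁] [Fintype ι₂] [Fintype ι]
  [DecidableEq ι₁] [DecidableEq ι₂] [DecidableEq ι] (e : ι₁ ⊕ ι₂ ≃ ι)

omit [Fintype ι₁] [Fintype ι₂] [Fintype ι] [DecidableEq ι₁] [DecidableEq ι₂] [DecidableEq ι] in
/-- `(M₁ ⊕ M₂)ᵀ = M₁ᵀ ⊕ M₂ᵀ` re-enumerated along `e`. [cite: Kudla1994, §2] -/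
theorem transpose_reindex_fromBlocks_diag (M₁ : Matrix ι₁ ι₁ K) (M₂ : Matrix ι₂ ι₂ K) :
    (Matrix.reindex e e (Matrix.fromBlocks M₁ 0 0 M₂))ᵀ = Matrix.reindex e e (Matrix.fromBlocks M₁ᵀ 0 0 M₂ᵀ) := by
  rw [Matrix.transpose_reindex, Matrix.fromBlocks_transpose, Matrix.transpose_zero, Matrix.transpose_zero]

/-- `(M₁ ⊕ M₂)⁻¹ = M₁⁻¹ ⊕ M₂⁻¹` re-enumerated along `e`, for non-degenerate blocks. [cite: Kudla1994, §2] -/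
theorem inv_reindex_fromBlocks_diag {M₁ : Matrix ι₁ ι₁ K} {M₂ : Matrix ι₂ ι₂ K} (h₁ : IsUnit M₁.det) (h₂ : IsUnit M₂.det) :
    (Matrix.reindex e e (Matrix.fromBlocks M₁ 0 0 M₂))⁻¹ = Matrix.reindex e e (Matrix.fromBlocks M₁⁻¹ 0 0 M₂⁻¹) := by
  rw [Matrix.inv_reindex, Matrix.inv_fromBlocks_zero₂₁_of_isUnit_iff _ _ _
    (by rw [Matrix.isUnit_iff_isUnit_det, Matrix.isUnit_iff_isUnit_det]; exact ⟨fun _ => h₂, fun _ => h₁⟩),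
    Matrix.mul_zero, Matrix.zero_mul, neg_zero]

/-- the inverse of a block-diagonal `B = B₁ ⊕ B₂ ∈ GL_ι(K)` is `B₁⁻¹ ⊕ B₂⁻¹`. [cite: Kudla1994, §2] -/
theorem coe_inv_of_eq_reindex_fromBlocks (B₁ : GL ι₁ K) (B₂ : GL ι₂ K) (B : GL ι K)
    (hB : (B : Matrix ι ι K) = Matrix.reindex e e (Matrix.fromBlocks (B₁ : Matrix ι₁ ι₁ K) 0 0 (B₂ : Matrix ι₂ ι₂ K))) :
    ((B⁻¹ : GL ι K) : Matrix ι ι K) =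
      Matrix.reindex e e (Matrix.fromBlocks ((B₁⁻¹ : GL ι₁ K) : Matrix ι₁ ι₁ K) 0 0 ((B₂⁻¹ : GL ι₂ K) : Matrix ι₂ ι₂ K)) := by
  rw [Matrix.coe_units_inv, hB, inv_reindex_fromBlocks_diag e ((Matrix.isUnit_iff_isUnit_det _).1 B₁.isUnit)
    ((Matrix.isUnit_iff_isUnit_det _).1 B₂.isUnit), Matrix.coe_units_inv, Matrix.coe_units_inv]

end Blocks

/-! ## §2 [W3] Block sums of transported Levi and Weyl elements -/

section BlockSums

variable {K : Type*} [CommRing K] {ι₁ ι₂ ι : Type*} [Fintype ι₁] [Fintype ι₂] [Fintype ι]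
  [DecidableEq ι₁] [DecidableEq ι₂] [DecidableEq ι]
  (e : ι₁ ⊕ ι₂ ≃ ι) (T₁ : Matrix ι₁ ι₁ K) (T₂ : Matrix ι₂ ι₂ K) {T : Matrix ι ι K}
  (hT : T = Matrix.reindex e e (Matrix.fromBlocks T₁ 0 0 T₂))
  (hT₁ : IsUnit T₁.det) (hT₂ : IsUnit T₂.det) (hTd : IsUnit T.det)

/-- **[W3a] `(m(B₁) ⊕ 1)(1 ⊕ m(B₂)) = m(B₁ ⊕ B₂)`** for the transported Siegel Levi elements of `Sp(𝕎_{T₁})`, `Sp(𝕎_{T₂})`, `Sp(𝕎_T)`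
(`x ↦ B x`, `y ↦ T⁻¹B⁻ᵀT y` blockwise). [cite: MoeglinVignerasWaldspurger1987, Chap. 2 II.1 Rem. (6), II.2] -/
theorem spInl_transportSp_levi_mul_spInr (B₁ : GL ι₁ K) (B₂ : GL ι₂ K) (B : GL ι K)
    (hB : (B : Matrix ι ι K) = Matrix.reindex e e (Matrix.fromBlocks (B₁ : Matrix ι₁ ι₁ K) 0 0 (B₂ : Matrix ι₂ ι₂ K))) :
    spInl e T₁ T₂ hT (transportSp T₁ hT₁ (levi B₁)) * spInr e T₁ T₂ hT (transportSp T₂ hT₂ (levi B₂)) =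
      transportSp T hTd (levi B) := by
  apply Subtype.ext
  refine LinearEquiv.ext fun w => ?_
  rw [transportSp_levi, transportSp_levi, transportSp_levi]
  simp only [Subgroup.coe_mul, LinearEquiv.mul_apply, coe_spInl, coe_spInr, inrW_apply, inlW_apply, coe_leviSp_apply,
    resL_glue, resR_glue, glEquiv_apply, leviDual_apply, Prod.mk.injEq]
  refine ⟨?_, ?_⟩
  · rw [hB, reindex_fromBlocks_mulVec_eq_glue]
  · simp only [← Matrix.mulVec_mulVec]
    rw [coe_inv_of_eq_reindex_fromBlocks e B₁ B₂ B hB, transpose_reindex_fromBlocks_diag, hT, inv_reindex_fromBlocks_diag e hT₁ hT₂,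
      reindex_fromBlocks_mulVec_eq_glue, reindex_fromBlocks_mulVec_eq_glue, resL_glue, resR_glue,
      reindex_fromBlocks_mulVec_eq_glue, resL_glue, resR_glue]

/-- **[W3b] `(J₁ ⊕ 1)(1 ⊕ J₂) = J`** for the transported Weyl elements (`(x, y) ↦ (−T y, T⁻¹ x)` blockwise).
[cite: MoeglinVignerasWaldspurger1987, Chap. 2 II.1 Rem. (6), II.2] [cite: Weil1964, n° 6] -/
theorem spInl_transportSp_symJ_mul_spInr :
    spInl e T₁ T₂ hT (transportSp T₁ hT₁ (SymplecticGroup.symJ ι₁ K)) *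
        spInr e T₁ T₂ hT (transportSp T₂ hT₂ (SymplecticGroup.symJ ι₂ K)) =
      transportSp T hTd (SymplecticGroup.symJ ι K) := by
  apply Subtype.ext
  refine LinearEquiv.ext fun w => ?_
  rw [transportSp_J, transportSp_J, transportSp_J]
  simp only [Subgroup.coe_mul, LinearEquiv.mul_apply, coe_spInl, coe_spInr, inrW_apply, inlW_apply, coe_weylSp, weylσ_apply,
    resL_glue, resR_glue, weylGamma_apply, gramEquiv_symm_apply, Prod.mk.injEq]
  refine ⟨?_, ?_⟩
  · rw [glue_neg, hT, reindex_fromBlocks_mulVec_eq_glue]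
  · rw [hT, inv_reindex_fromBlocks_diag e hT₁ hT₂, reindex_fromBlocks_mulVec_eq_glue]

/-- **[W3] `(J⁻¹ m(B₁) ⊕ 1)(1 ⊕ J⁻¹ m(B₂)) = J⁻¹ m(B₁ ⊕ B₂)`** transported (the summands commute, ★ `spInl_mul_spInr_comm`).
[cite: MoeglinVignerasWaldspurger1987, Chap. 2 II.1 Rem. (6), II.2] -/
theorem spInl_transportSp_symJ_inv_mul_levi_mul_spInr (B₁ : GL ι₁ K) (B₂ : GL ι₂ K) (B : GL ι K)
    (hB : (B : Matrix ι ι K) = Matrix.reindex e e (Matrix.fromBlocks (B₁ : Matrix ι₁ ι₁ K) 0 0 (B₂ : Matrix ι₂ ι₂ K))) :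
    spInl e T₁ T₂ hT (transportSp T₁ hT₁ ((SymplecticGroup.symJ ι₁ K)⁻¹ * levi B₁)) *
        spInr e T₁ T₂ hT (transportSp T₂ hT₂ ((SymplecticGroup.symJ ι₂ K)⁻¹ * levi B₂)) =
      transportSp T hTd ((SymplecticGroup.symJ ι K)⁻¹ * levi B) := by
  have hc1 : spInl e T₁ T₂ hT (transportSp T₁ hT₁ (levi B₁)) * (spInr e T₁ T₂ hT (transportSp T₂ hT₂ (SymplecticGroup.symJ ι₂ K)))⁻¹ =
      (spInr e T₁ T₂ hT (transportSp T₂ hT₂ (SymplecticGroup.symJ ι₂ K)))⁻¹ * spInl e T₁ T₂ hT (transportSp T₁ hT₁ (levi B₁)) := by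
    rw [← map_inv (spInr e T₁ T₂ hT)]
    exact spInl_mul_spInr_comm e T₁ T₂ hT _ _
  have hc3 : (spInl e T₁ T₂ hT (transportSp T₁ hT₁ (SymplecticGroup.symJ ι₁ K)) * spInr e T₁ T₂ hT (transportSp T₂ hT₂ (SymplecticGroup.symJ ι₂ K)))⁻¹ =
      (spInl e T₁ T₂ hT (transportSp T₁ hT₁ (SymplecticGroup.symJ ι₁ K)))⁻¹ * (spInr e T₁ T₂ hT (transportSp T₂ hT₂ (SymplecticGroup.symJ ι₂ K)))⁻¹ := by
    rw [_root_.mul_inv_rev, ← map_inv (spInl e T₁ T₂ hT), ← map_inv (spInr e T₁ T₂ hT)]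
    exact (spInl_mul_spInr_comm e T₁ T₂ hT _ _).symm
  rw [map_mul (transportSp T₁ hT₁), map_mul (transportSp T₂ hT₂), map_mul (transportSp T hTd), map_inv (transportSp T₁ hT₁),
    map_inv (transportSp T₂ hT₂), map_inv (transportSp T hTd), map_mul (spInl e T₁ T₂ hT), map_mul (spInr e T₁ T₂ hT),
    map_inv (spInl e T₁ T₂ hT), map_inv (spInr e T₁ T₂ hT),
    ← spInl_transportSp_levi_mul_spInr e T₁ T₂ hT hT₁ hT₂ hTd B₁ B₂ B hB, ← spInl_transportSp_symJ_mul_spInr e T₁ T₂ hT hT₁ hT₂ hTd, hc3]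
  calc (spInl e T₁ T₂ hT (transportSp T₁ hT₁ (SymplecticGroup.symJ ι₁ K)))⁻¹ * spInl e T₁ T₂ hT (transportSp T₁ hT₁ (levi B₁)) *
        ((spInr e T₁ T₂ hT (transportSp T₂ hT₂ (SymplecticGroup.symJ ι₂ K)))⁻¹ * spInr e T₁ T₂ hT (transportSp T₂ hT₂ (levi B₂)))
      = (spInl e T₁ T₂ hT (transportSp T₁ hT₁ (SymplecticGroup.symJ ι₁ K)))⁻¹ *
          (spInl e T₁ T₂ hT (transportSp T₁ hT₁ (levi B₁)) * (spInr e T₁ T₂ hT (transportSp T₂ hT₂ (SymplecticGroup.symJ ι₂ K)))⁻¹) *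
          spInr e T₁ T₂ hT (transportSp T₂ hT₂ (levi B₂)) := by simp only [mul_assoc]
    _ = (spInl e T₁ T₂ hT (transportSp T₁ hT₁ (SymplecticGroup.symJ ι₁ K)))⁻¹ *
          ((spInr e T₁ T₂ hT (transportSp T₂ hT₂ (SymplecticGroup.symJ ι₂ K)))⁻¹ * spInl e T₁ T₂ hT (transportSp T₁ hT₁ (levi B₁))) *
          spInr e T₁ T₂ hT (transportSp T₂ hT₂ (levi B₂)) := by rw [hc1]
    _ = (spInl e T₁ T₂ hT (transportSp T₁ hT₁ (SymplecticGroup.symJ ι₁ K)))⁻¹ *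
          (spInr e T₁ T₂ hT (transportSp T₂ hT₂ (SymplecticGroup.symJ ι₂ K)))⁻¹ *
          (spInl e T₁ T₂ hT (transportSp T₁ hT₁ (levi B₁)) * spInr e T₁ T₂ hT (transportSp T₂ hT₂ (levi B₂))) := by simp only [mul_assoc]

/-- **[W3′] the same in product form**: `spInl ((tS₁ J)⁻¹ tS₁(m B₁)) * spInr ((tS₂ J)⁻¹ tS₂(m B₂)) = (tS J)⁻¹ tS (m B)` — the shape of ★ F4a's
Cayley letter `hW`. [cite: MoeglinVignerasWaldspurger1987, Chap. 2 II.1 Rem. (6), II.2] -/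
theorem spInl_mul_spInr_cayleyLetter (B₁ : GL ι₁ K) (B₂ : GL ι₂ K) (B : GL ι K)
    (hB : (B : Matrix ι ι K) = Matrix.reindex e e (Matrix.fromBlocks (B₁ : Matrix ι₁ ι₁ K) 0 0 (B₂ : Matrix ι₂ ι₂ K))) :
    spInl e T₁ T₂ hT ((transportSp T₁ hT₁ (SymplecticGroup.symJ ι₁ K))⁻¹ * transportSp T₁ hT₁ (levi B₁)) *
        spInr e T₁ T₂ hT ((transportSp T₂ hT₂ (SymplecticGroup.symJ ι₂ K))⁻¹ * transportSp T₂ hT₂ (levi B₂)) =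
      (transportSp T hTd (SymplecticGroup.symJ ι K))⁻¹ * transportSp T hTd (levi B) := by
  rw [← map_inv (transportSp T₁ hT₁), ← map_mul (transportSp T₁ hT₁), ← map_inv (transportSp T₂ hT₂), ← map_mul (transportSp T₂ hT₂),
    spInl_transportSp_symJ_inv_mul_levi_mul_spInr e T₁ T₂ hT hT₁ hT₂ hTd B₁ B₂ B hB, map_mul (transportSp T hTd), map_inv (transportSp T hTd)]

end BlockSums

/-! ## §3 [W4] Frame transport of transported Levi and Weyl elements -/

section Frame

variable (F : Type) [Field F] [NumberField F] (v : HeightOneSpectrum (𝓞 F)) (N : ℕ) {T T' : Matrix (Fin N) (Fin N) F}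
  (P : GL (Fin N) F) (hP : (P : Matrix (Fin N) (Fin N) F)ᵀ * T * (P : Matrix (Fin N) (Fin N) F) = T')

include hP in
/-- `P̂ᵀ 𝕋_v P̂ = 𝕋′_v` over `F_v`. [cite: Weil1964, n° 34] -/
theorem transpose_framePv_mul_localGram_mul_framePv :
    ((framePv F v N P : GL (Fin N) (v.adicCompletion F)) : Matrix (Fin N) (Fin N) (v.adicCompletion F))ᵀ * localGram F N T v *
        ((framePv F v N P : GL (Fin N) (v.adicCompletion F)) : Matrix (Fin N) (Fin N) (v.adicCompletion F)) =
      localGram F N T' v := by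
  rw [coe_framePv]
  change ((P : Matrix (Fin N) (Fin N) F).map (algebraMap F (v.adicCompletion F)))ᵀ * T.map (algebraMap F (v.adicCompletion F)) *
      (P : Matrix (Fin N) (Fin N) F).map (algebraMap F (v.adicCompletion F)) = T'.map (algebraMap F (v.adicCompletion F))
  rw [← hP, Matrix.map_mul, Matrix.map_mul, Matrix.transpose_map]

include hP in
/-- `𝕋′_v⁻¹ = P̂⁻¹ 𝕋_v⁻¹ P̂⁻ᵀ`. [cite: Weil1964, n° 34] -/
theorem localGram_inv_eq_frame (hTd : IsUnit (localGram F N T v).det) :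
    (localGram F N T' v)⁻¹ =
      ((framePv F v N P)⁻¹ : GL (Fin N) (v.adicCompletion F)).1 * (localGram F N T v)⁻¹ *
        (((framePv F v N P)⁻¹ : GL (Fin N) (v.adicCompletion F)).1)ᵀ := by
  rw [← transpose_framePv_mul_localGram_mul_framePv F v N P hP]
  refine Matrix.inv_eq_right_inv ?_
  calc ((framePv F v N P).1)ᵀ * localGram F N T v * (framePv F v N P).1 *
        (((framePv F v N P)⁻¹ : GL (Fin N) (v.adicCompletion F)).1 * (localGram F N T v)⁻¹ *
          (((framePv F v N P)⁻¹ : GL (Fin N) (v.adicCompletion F)).1)ᵀ)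
      = ((framePv F v N P).1)ᵀ * (localGram F N T v * ((framePv F v N P).1 * ((framePv F v N P)⁻¹ : GL (Fin N) (v.adicCompletion F)).1) *
          (localGram F N T v)⁻¹) * (((framePv F v N P)⁻¹ : GL (Fin N) (v.adicCompletion F)).1)ᵀ := by simp only [Matrix.mul_assoc]
    _ = 1 := by
        rw [← Units.val_mul, mul_inv_cancel, Units.val_one, Matrix.mul_one, Matrix.mul_nonsing_inv _ hTd, Matrix.mul_one,
          transpose_mul_transpose_inv]

/-- the symplectic frame transport on vectors: `(frameSp g) w = frameW (g (frameW⁻¹ w))` (unfolding, ★ `symplecticConj_apply`). [cite: Weil1964, n° 34] -/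
theorem coe_frameSp_apply (g : LocalSp F N T' v) (w : (Fin N → v.adicCompletion F) × (Fin N → v.adicCompletion F)) :
    ((frameSp F v N P hP g : LocalSp F N T v) :
        ((Fin N → v.adicCompletion F) × (Fin N → v.adicCompletion F)) ≃ₗ[v.adicCompletion F]
          ((Fin N → v.adicCompletion F) × (Fin N → v.adicCompletion F))) w =
      frameW F v N P ((g : ((Fin N → v.adicCompletion F) × (Fin N → v.adicCompletion F)) ≃ₗ[v.adicCompletion F]
        ((Fin N → v.adicCompletion F) × (Fin N → v.adicCompletion F))) ((frameW F v N P).symm w)) :=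
  rfl

/-- `frameW⁻¹ (x, y) = (P̂⁻¹ x, P̂⁻¹ y)`. [cite: Weil1964, n° 34] -/
theorem frameW_symm_apply (w : (Fin N → v.adicCompletion F) × (Fin N → v.adicCompletion F)) :
    (frameW F v N P).symm w = ((frameLin F v N P).symm w.1, (frameLin F v N P).symm w.2) :=
  rfl

include hP in
/-- **[W4a] the frame transport of a transported Siegel Levi is a transported Siegel Levi**: `frameSp (tS′(m(B))) = tS(m(P̂ B P̂⁻¹))`
(no orthogonality of `P` needed: `P̂ 𝕋′⁻¹B⁻ᵀ𝕋′ P̂⁻¹ = 𝕋⁻¹ (P̂BP̂⁻¹)⁻ᵀ 𝕋` from `P̂ᵀ 𝕋 P̂ = 𝕋′`). [cite: MoeglinVignerasWaldspurger1987, Chap. 2 II.2] [cite: Weil1964, n° 34] -/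
theorem frameSp_transportSp_levi (hTd : IsUnit (localGram F N T v).det) (hT'd : IsUnit (localGram F N T' v).det)
    (B : GL (Fin N) (v.adicCompletion F)) :
    frameSp F v N P hP (transportSp (localGram F N T' v) hT'd (levi B)) =
      transportSp (localGram F N T v) hTd (levi (framePv F v N P * B * (framePv F v N P)⁻¹)) := by
  apply Subtype.ext
  refine LinearEquiv.ext fun w => ?_
  rw [coe_frameSp_apply, transportSp_levi, transportSp_levi, coe_leviSp_apply, coe_leviSp_apply, frameW_symm_apply, frameW_apply]
  simp only [glEquiv_apply, leviDual_apply, frameLin_apply, frameLin_symm_apply, ← coe_framePv, Matrix.mulVec_mulVec, Units.val_mul,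
    Prod.mk.injEq]
  refine ⟨by simp only [Matrix.mul_assoc], ?_⟩
  congr 1
  rw [localGram_inv_eq_frame F v N P hP hTd, ← transpose_framePv_mul_localGram_mul_framePv F v N P hP, _root_.mul_inv_rev, _root_.mul_inv_rev, inv_inv,
    Units.val_mul, Units.val_mul, Matrix.transpose_mul, Matrix.transpose_mul]
  simp only [Matrix.mul_assoc, Units.mul_inv_cancel_left, Units.mul_inv, Matrix.mul_one]

/-- for an ORTHOGONAL frame `P Pᵀ = 1`: `P̂⁻¹ = P̂ᵀ`. [cite: Weil1964, n° 34] -/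
theorem coe_framePv_inv_of_orthogonal (hPP : (P : Matrix (Fin N) (Fin N) F) * (P : Matrix (Fin N) (Fin N) F)ᵀ = 1) :
    (((framePv F v N P)⁻¹ : GL (Fin N) (v.adicCompletion F)).1) =
      ((framePv F v N P : GL (Fin N) (v.adicCompletion F)) : Matrix (Fin N) (Fin N) (v.adicCompletion F))ᵀ := by
  refine Units.inv_eq_of_mul_eq_one_right ?_
  rw [coe_framePv, ← Matrix.transpose_map, ← Matrix.map_mul, hPP, Matrix.map_one (algebraMap F (v.adicCompletion F)) (map_zero _) (map_one _)]

include hP in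
/-- **[W4b] an orthogonal frame transport fixes the transported Weyl element**: `P Pᵀ = 1 ⇒ frameSp (tS′ J) = tS J`
(`P̂ 𝕋′ P̂⁻¹ = 𝕋`, `P̂ 𝕋′⁻¹ P̂⁻¹ = 𝕋⁻¹`). [cite: MoeglinVignerasWaldspurger1987, Chap. 2 II.2] [cite: Weil1964, n° 6, n° 34] -/
theorem frameSp_transportSp_symJ (hPP : (P : Matrix (Fin N) (Fin N) F) * (P : Matrix (Fin N) (Fin N) F)ᵀ = 1)
    (hTd : IsUnit (localGram F N T v).det) (hT'd : IsUnit (localGram F N T' v).det) :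
    frameSp F v N P hP (transportSp (localGram F N T' v) hT'd (SymplecticGroup.symJ (Fin N) (v.adicCompletion F))) =
      transportSp (localGram F N T v) hTd (SymplecticGroup.symJ (Fin N) (v.adicCompletion F)) := by
  have hPt := coe_framePv_inv_of_orthogonal F v N P hPP
  apply Subtype.ext
  refine LinearEquiv.ext fun w => ?_
  rw [coe_frameSp_apply, transportSp_J, transportSp_J, coe_weylSp, coe_weylSp, weylσ_apply, weylσ_apply, frameW_symm_apply, frameW_apply]
  simp only [weylGamma_apply, gramEquiv_symm_apply, frameLin_apply, frameLin_symm_apply, ← coe_framePv, Matrix.mulVec_neg,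
    Matrix.mulVec_mulVec, Prod.mk.injEq]
  refine ⟨?_, ?_⟩
  · rw [← transpose_framePv_mul_localGram_mul_framePv F v N P hP, ← hPt]
    simp only [Matrix.mul_assoc, Units.mul_inv_cancel_left, Units.mul_inv, Matrix.mul_one]
  · rw [localGram_inv_eq_frame F v N P hP hTd, hPt, Matrix.transpose_transpose, ← hPt]
    simp only [Matrix.mul_assoc, Units.mul_inv_cancel_left, Units.mul_inv, Matrix.mul_one]

include hP in
/-- **[W4] THE CAYLEY LETTER UNDER AN ORTHOGONAL FRAME**: `frameSp ((tS′ J)⁻¹ · tS′(m B)) = (tS J)⁻¹ · tS(m(P̂ B P̂⁻¹))`.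
[cite: MoeglinVignerasWaldspurger1987, Chap. 2 II.1 Rem. (6), II.2] [cite: Weil1964, n° 34] -/
theorem frameSp_transportSp_symJ_inv_mul_levi (hPP : (P : Matrix (Fin N) (Fin N) F) * (P : Matrix (Fin N) (Fin N) F)ᵀ = 1)
    (hTd : IsUnit (localGram F N T v).det) (hT'd : IsUnit (localGram F N T' v).det) (B : GL (Fin N) (v.adicCompletion F)) :
    frameSp F v N P hP ((transportSp (localGram F N T' v) hT'd (SymplecticGroup.symJ (Fin N) (v.adicCompletion F)))⁻¹ *
        transportSp (localGram F N T' v) hT'd (levi B)) =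
      (transportSp (localGram F N T v) hTd (SymplecticGroup.symJ (Fin N) (v.adicCompletion F)))⁻¹ *
        transportSp (localGram F N T v) hTd (levi (framePv F v N P * B * (framePv F v N P)⁻¹)) := by
  rw [map_mul (frameSp F v N P hP), map_inv (frameSp F v N P hP), frameSp_transportSp_symJ F v N P hP hPP hTd hT'd,
    frameSp_transportSp_levi F v N P hP hTd hT'd B]

end Frame

end Summit.HodgeConjecture.HodgeConjecture.Cruxes.HLiu418.K2LiuSymplecticBlockLeviTransport

end
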